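import Summits.ValiantsHypothesis.ValiantsHypothesis.Theorems.LacunarySymmetroidMatrixDescartesCensusDoorA34NineInertiaTable

/-!
# `MatrixDescartes` census — DOOR A at `(3,4)`: the CHAMBER-II ONE-CROSSING LAW, arithmetic core (kernel) and statement (paper)

HONEST FRAMING.  Object-search cell `pub-symmetroid`, door-A seat `val-sym-door-p3` (g16); helper file beside the OPEN typed statement
`DoorA34 = PosRootLawAt 3 4 18` (route item `Theses.LacunarySymmetroid.DoorA34`, stmt-ValiantsHypothesis-19980), asserted nowhere here.

THE LAW (paper, this seat; report DOOR-A34-P3G16 §5).  Let `A, B` be real symmetric `3 × 3` with `A` of inertia `(1,2)` (eigenvalues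
`p > 0 > −q ≥ −r`) and `p < q` (implied by `e₂(A) > 0`), `tr B < 0`, and `tr A · tr B − tr(A B) < 0` — three of the nine sign conditions that
`NineInertia.signs_chamber_II` FORCES on the letters `S₁ = A`, `S₂ = B` of a nine-row `1 + X^{d₁} A + X^{d₂} B` in chamber II (`2d₁ < d₂ < 3d₁`).
Then for every `u > 0` and every bottom eigenvector `x` of `A + uB` (eigenvalue `t = λ_min(A+uB) < 0`):  `2u·σ_B(x) < −t`, i.e. the log-slope
`E = u t₁′/t₁` of the bottom eigen-branch exceeds `−1/2` (Hellmann–Feynman `t₁′ = σ_B(x)`), i.e. `√u · λ_min(A + uB)` is strictly DECREASING.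
Consequence: with `u = x^{d₂−d₁}`, `β = d₁/(d₂−d₁) ∈ (1/2, 1)` in chamber II, `c(u) = −u^β λ_min(A+uB)` is strictly increasing, so
`λ_min(1 + x^{d₁}A + x^{d₂}B) = x^{d₁} u^{−β}(1 − c(u))` changes sign EXACTLY ONCE on `(0,∞)`: **a nine-row with a positive definite bottom letter on a
chamber-II support has exactly one λ_min-crossing — it is never the pure-λ_min source the flag ladder needs** (Claim L, chamber II).  PROOF of the
law: the Rayleigh bounds `t ≤ σ_{A+uB}(v_i) = α_i + u·σ_B(v_i)` at the three eigenvectors of `A`, `σ_A(x) ≥ −r`, `tr B = Σ σ_B(v_i)`,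
`tr(AB) = Σ α_i σ_B(v_i)`, and the elementary real-arithmetic core below.

THIS FILE types the ARITHMETIC CORE `chamberII_core` (all the algebra of the proof, hypotheses = the Rayleigh/trace facts as real inequalities;
`nlinarith`-free explicit steps) and its β-form `chamberII_core_beta` (`u·b + β·t < 0` for `β ≥ 1/2`).  The eigen-theoretic wrapper (spectral
decomposition of `A`, Hellmann–Feynman / one-sided derivatives of `λ_min`, the sign-change count) is NOT typed here.  Nothing here bounds
`ζ_sym(3,3)` or `ζ_sym(3,4)`; `DoorA34`, Claim L (chambers III/IV) and `MatrixDescartes` (stmt-ValiantsHypothesis-18050) stay OPEN; nothing on `VP ≠ VNP`.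
[folklore] Rayleigh quotient bounds; elementary real arithmetic.
-/

open Polynomial Finset Matrix

-- `Summit.ValiantsHypothesis.ValiantsHypothesis.…` repeats a component by the D-0017 layout
-- (single-conjunct summit), which the `dupNamespace` linter flags; the name is mandated.
set_option linter.dupNamespace false

namespace Summit.ValiantsHypothesis.ValiantsHypothesis.Theorems.LacunarySymmetroidMatrixDescartes.Census

namespace NineInertia

/-- **CHAMBER-II ONE-CROSSING LAW, arithmetic core.**  Data: the eigenvalues `p > 0 > −q ≥ −r` of `A` with `p < q`; the diagonal
`b₁₁, b₂₂, b₃₃` of `B` in that eigenbasis with `tr B = b₁₁ + b₂₂ + b₃₃ < 0` and the mixed-sign condition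
`p (b₂₂ + b₃₃) < q (b₁₁ + b₃₃) + r (b₁₁ + b₂₂)` (`= tr A·tr B − tr(AB) < 0`); a parameter `u > 0`; the bottom eigenvalue `t` of `A + uB` with the two
Rayleigh bounds `t ≤ −r + u b₃₃`, `t ≤ −q + u b₂₂`; and the bottom eigenvector's Rayleigh data `t = a + u b` (`a = σ_A(x) ≥ −r`, `b = σ_B(x)`).
Conclusion: `2u·b < −t` (the log-slope of the bottom branch exceeds `−1/2`).  Proof: if `2ub ≥ −t` then `t ≥ −2r/3`, so `u b₃₃ ≥ t + r > 0`; the trace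
and mixed conditions give `(p+q) b₂₂ + (p+r) b₃₃ < 0`, whence `(p+q)(t+q) + (p+r)(t+r) < 0`, contradicting `t ≥ −2r/3` and `p < q`
(`3q² + r² − 2qr + 3pq − pr > 0`). [folklore] -/
theorem chamberII_core {p q r u t a b b₁₁ b₂₂ b₃₃ : ℝ} (hp : 0 < p) (hq : 0 < q) (hqr : q ≤ r) (hpq : p < q)
    (htrB : b₁₁ + b₂₂ + b₃₃ < 0) (hMX : p * (b₂₂ + b₃₃) < q * (b₁₁ + b₃₃) + r * (b₁₁ + b₂₂))
    (hu : 0 < u) (ht3 : t ≤ -r + u * b₃₃) (ht2 : t ≤ -q + u * b₂₂) (ha : -r ≤ a) (htab : t = a + u * b) :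
    2 * (u * b) < -t := by
  by_contra H
  push Not at H
  -- `u b ≤ t + r`, hence `t ≥ −2r/3`
  have hub : u * b ≤ t + r := by linarith
  have ht : -(2 * r) ≤ 3 * t := by linarith
  -- `u b₃₃ ≥ t + r > 0`, so `b₃₃ > 0`
  have h33 : t + r ≤ u * b₃₃ := by linarith
  have h33pos : 0 < u * b₃₃ := by linarith
  have hb33 : 0 < b₃₃ := pos_of_mul_pos_right h33pos hu.le
  -- trace + mixed sign ⇒ `(p+q) b₂₂ + (p+r) b₃₃ < 0`
  have hqr0 : 0 < q + r := by linarith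
  have hkey : (p + q) * b₂₂ + (p + r) * b₃₃ < 0 := by
    have h1 : (q + r) * b₁₁ < -((q + r) * (b₂₂ + b₃₃)) := by nlinarith
    nlinarith
  -- multiply by `u > 0` and chain with the Rayleigh bounds
  have hkey' : (p + q) * (u * b₂₂) + (p + r) * (u * b₃₃) < 0 := by nlinarith
  have h22 : t + q ≤ u * b₂₂ := by linarith
  have hpq0 : 0 < p + q := by linarith
  have hpr0 : 0 < p + r := by linarith
  have hsum : (p + q) * (t + q) + (p + r) * (t + r) < 0 := by nlinarith
  -- with `3t ≥ −2r`: `3(p+q)q − 2(p+q)r + (p+r)r < 0`, i.e. `3q² + r² − 2qr + 3pq − pr < 0`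
  have hpoly : 3 * q ^ 2 + r ^ 2 - 2 * q * r + 3 * p * q - p * r < 0 := by nlinarith
  -- but this quantity is positive: `(r² − 2qr + 3q²) + p(3q − r)` with `0 < p < q`
  rcases le_or_gt r (3 * q) with h3 | h3
  · nlinarith [sq_nonneg (r - q), mul_nonneg hp.le (by linarith : (0:ℝ) ≤ 3 * q - r)]
  · -- `p (3q − r) > q (3q − r)` since `p < q` and `3q − r < 0`
    nlinarith [mul_pos (by linarith : (0:ℝ) < q - p) (by linarith : (0:ℝ) < r - 3 * q), sq_nonneg (2 * r - 3 * q)]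

/-- **β-form of the core**: under the same data, `u·b + β·t < 0` for every `β ≥ 1/2` — so in chamber II (`β = d₁/(d₂−d₁) ∈ (1/2,1)`) the critical-point
equation `u t₁′ + β t₁ = 0` of `c(u) = −u^β λ_min(A+uB)` (the `D_β` points of report G15 §3e on the root-carrying piece) has NO solution: `c` is strictly
increasing and `λ_min` of the pencil crosses zero exactly once. [folklore] -/
theorem chamberII_core_beta {p q r u t a b b₁₁ b₂₂ b₃₃ β : ℝ} (hp : 0 < p) (hq : 0 < q) (hqr : q ≤ r) (hpq : p < q)
    (htrB : b₁₁ + b₂₂ + b₃₃ < 0) (hMX : p * (b₂₂ + b₃₃) < q * (b₁₁ + b₃₃) + r * (b₁₁ + b₂₂))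
    (hu : 0 < u) (ht3 : t ≤ -r + u * b₃₃) (ht2 : t ≤ -q + u * b₂₂) (ha : -r ≤ a) (htab : t = a + u * b)
    (hβ : (1:ℝ) / 2 ≤ β) : u * b + β * t < 0 := by
  have h := chamberII_core hp hq hqr hpq htrB hMX hu ht3 ht2 ha htab
  -- `t < 0`: from `t ≤ −q + u b₂₂` … simplest: `3t ≤ tr` is not available here, but `2ub < −t` and `ub ≥ ?` — use instead `t ≤ -r + u b₃₃` twice?  Direct:
  -- if `t ≥ 0` then `2ub < −t ≤ 0` so `ub < 0`, and `u b + β t`… we need `t < 0` genuinely: it follows from `ht2`, `ht3`, `htrB`, `hMX` as in the core.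
  have ht0 : t < 0 := by
    by_contra H
    push Not at H
    have h33pos : 0 < u * b₃₃ := by linarith
    have hb33 : 0 < b₃₃ := pos_of_mul_pos_right h33pos hu.le
    have hkey : (p + q) * b₂₂ + (p + r) * b₃₃ < 0 := by
      have h1 : (q + r) * b₁₁ < -((q + r) * (b₂₂ + b₃₃)) := by nlinarith
      nlinarith
    have h22pos : 0 < u * b₂₂ := by linarith
    have hb22 : 0 < b₂₂ := pos_of_mul_pos_right h22pos hu.le
    nlinarith
  nlinarith

/-! ## The law for a DIAGONAL middle letter (appended; supersedes the module docstring's «wrapper NOT typed» for the diagonal gauge — the general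
symmetric case is this one after the orthogonal congruence diagonalising `A`; the one-variable monotonicity / crossing count stays paper) -/

/-- Rayleigh bound at a coordinate vector: if `t·|y|² ≤ σ_M(y)` for all `y`, then `t ≤ M i i` (take `y = e_i`); here for
`M = diagonal α + u·B` on `Fin 3`, written out at the three indices. [folklore] -/
theorem rayleigh_coord_three (α : Fin 3 → ℝ) (B : Matrix (Fin 3) (Fin 3) ℝ) (u t : ℝ)
    (hmin : ∀ y : Fin 3 → ℝ, t * (y ⬝ᵥ y) ≤ y ⬝ᵥ (Matrix.diagonal α + u • B) *ᵥ y) :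
    t ≤ α 0 + u * B 0 0 ∧ t ≤ α 1 + u * B 1 1 ∧ t ≤ α 2 + u * B 2 2 := by
  have h0 := hmin ![1, 0, 0]
  have h1 := hmin ![0, 1, 0]
  have h2 := hmin ![0, 0, 1]
  simp [Matrix.mulVec, dotProduct, Fin.sum_univ_three, Matrix.add_apply, Matrix.smul_apply, Matrix.diagonal,
    Matrix.of_apply] at h0 h1 h2
  exact ⟨by linarith, by linarith, by linarith⟩

/-- **CHAMBER-II ONE-CROSSING LAW (diagonal middle letter).**  Let `A = diagonal α` with `α 0 > 0 > α 1 ≥ α 2` and `α 0 < −α 1` (the sign data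
of a chamber-II nine-row: inertia `(1,2)` and `e₂(A) > 0`, cf. `lt_neg_of_e2_pos`), `B` any real `3 × 3` matrix with `tr B < 0` and
`tr A · tr B − tr(A B) < 0`.  If `x` is a unit BOTTOM eigenvector of `A + uB` (`u > 0`): `(A + uB) x = t x` with `t·|y|² ≤ σ_{A+uB}(y)` for all `y`,
then `2u·σ_B(x) < −t` — the log-slope of the bottom eigen-branch exceeds `−1/2`.  (General symmetric `A`: conjugate by the orthogonal matrix
diagonalising `A`; all hypotheses and the conclusion are congruence-invariant.) [folklore] -/
theorem chamberII_logSlope_diag (α : Fin 3 → ℝ) (B : Matrix (Fin 3) (Fin 3) ℝ)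
    (h0 : 0 < α 0) (h1 : α 1 < 0) (h12 : α 2 ≤ α 1) (hpq : α 0 < -α 1)
    (htrB : B.trace < 0) (hMX : (Matrix.diagonal α).trace * B.trace - (Matrix.diagonal α * B).trace < 0)
    {u t : ℝ} (hu : 0 < u) {x : Fin 3 → ℝ} (hx1 : x ⬝ᵥ x = 1)
    (heig : (Matrix.diagonal α + u • B) *ᵥ x = t • x)
    (hmin : ∀ y : Fin 3 → ℝ, t * (y ⬝ᵥ y) ≤ y ⬝ᵥ (Matrix.diagonal α + u • B) *ᵥ y) :
    2 * (u * (x ⬝ᵥ B *ᵥ x)) < -t := by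
  obtain ⟨r0, r1, r2⟩ := rayleigh_coord_three α B u t hmin
  -- traces in coordinates
  have htr : B.trace = B 0 0 + B 1 1 + B 2 2 := by rw [Matrix.trace_fin_three]
  have htrAB : (Matrix.diagonal α * B).trace = α 0 * B 0 0 + α 1 * B 1 1 + α 2 * B 2 2 := by
    rw [Matrix.trace_fin_three]; simp [Matrix.diagonal_mul]
  have htrA : (Matrix.diagonal α).trace = α 0 + α 1 + α 2 := by
    rw [Matrix.trace_fin_three]; simp [Matrix.diagonal]
  rw [htr, htrAB, htrA] at hMX
  rw [htr] at htrB
  -- the bottom eigenvector's Rayleigh data: t = a + u b with a = σ_A(x) ≥ α 2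
  set a : ℝ := x ⬝ᵥ Matrix.diagonal α *ᵥ x with ha_def
  set b : ℝ := x ⬝ᵥ B *ᵥ x with hb_def
  have htab : t = a + u * b := by
    have h := congrArg (fun v => x ⬝ᵥ v) heig
    simp only [Matrix.add_mulVec, Matrix.smul_mulVec, dotProduct_add, dotProduct_smul, smul_eq_mul, hx1, mul_one] at h
    linarith
  have ha : -(-α 2) ≤ a := by
    have hx : x ⬝ᵥ x = x 0 * x 0 + x 1 * x 1 + x 2 * x 2 := by simp [dotProduct, Fin.sum_univ_three]
    have haexp : a = α 0 * (x 0 * x 0) + α 1 * (x 1 * x 1) + α 2 * (x 2 * x 2) := by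
      simp [ha_def, dotProduct, Matrix.mulVec_diagonal, Fin.sum_univ_three]; ring
    rw [haexp, neg_neg]
    rw [hx] at hx1
    nlinarith [mul_self_nonneg (x 0), mul_self_nonneg (x 1), mul_self_nonneg (x 2)]
  -- the arithmetic core with p = α 0, q = −α 1, r = −α 2
  have key := chamberII_core (p := α 0) (q := -α 1) (r := -α 2) (u := u) (t := t) (a := a) (b := b)
    (b₁₁ := B 0 0) (b₂₂ := B 1 1) (b₃₃ := B 2 2) h0 (by linarith) (by linarith) hpq (by linarith) (by nlinarith) hu
    (by linarith) (by linarith) ha htab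
  simpa [hb_def] using key

/-- The sign datum `α 0 < −α 1` used above follows from `e₂(A) > 0` for `A = diagonal α` of inertia `(1,2)`:
`α₀α₁ + α₀α₂ + α₁α₂ > 0` with `α 0 > 0 > α 1 ≥ α 2` gives `α 0 (−α 1 − α 2) < α 1 α 2 ≤ (−α 1)(−α 1 − α 2)`. [folklore] -/
theorem lt_neg_of_e2_pos (α : Fin 3 → ℝ) (h0 : 0 < α 0) (h1 : α 1 < 0) (h12 : α 2 ≤ α 1)
    (he2 : 0 < α 0 * α 1 + α 0 * α 2 + α 1 * α 2) : α 0 < -α 1 := by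
  nlinarith [mul_pos h0 (by linarith : (0:ℝ) < -α 2), mul_nonneg (by linarith : (0:ℝ) ≤ -α 1) (by linarith : (0:ℝ) ≤ α 1 - α 2)]

/-- **β-form (diagonal middle letter)**: under the same hypotheses `u·σ_B(x) + β·t < 0` for every `β ≥ 1/2` — no `D_β` point of the
root-carrying piece exists in chamber II (`β = d₁/(d₂−d₁) ∈ (1/2,1)`), so `−u^β λ_min(A+uB)` is strictly increasing and the pencil's `λ_min`
crosses zero exactly once (paper consequence; the one-variable monotonicity step is not typed). [folklore] -/
theorem chamberII_noDbeta_diag (α : Fin 3 → ℝ) (B : Matrix (Fin 3) (Fin 3) ℝ)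
    (h0 : 0 < α 0) (h1 : α 1 < 0) (h12 : α 2 ≤ α 1) (hpq : α 0 < -α 1)
    (htrB : B.trace < 0) (hMX : (Matrix.diagonal α).trace * B.trace - (Matrix.diagonal α * B).trace < 0)
    {u t β : ℝ} (hu : 0 < u) (hβ : (1:ℝ) / 2 ≤ β) {x : Fin 3 → ℝ} (hx1 : x ⬝ᵥ x = 1)
    (heig : (Matrix.diagonal α + u • B) *ᵥ x = t • x)
    (hmin : ∀ y : Fin 3 → ℝ, t * (y ⬝ᵥ y) ≤ y ⬝ᵥ (Matrix.diagonal α + u • B) *ᵥ y) :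
    u * (x ⬝ᵥ B *ᵥ x) + β * t < 0 := by
  have h := chamberII_logSlope_diag α B h0 h1 h12 hpq htrB hMX hu hx1 heig hmin
  -- `t < 0` from `3t ≤ tr(A + uB) < 0`
  obtain ⟨r0, r1, r2⟩ := rayleigh_coord_three α B u t hmin
  have htr : B.trace = B 0 0 + B 1 1 + B 2 2 := by rw [Matrix.trace_fin_three]
  rw [htr] at htrB
  have ht0 : t < 0 := by nlinarith
  nlinarith

end NineInertia

end Summit.ValiantsHypothesis.ValiantsHypothesis.Theorems.LacunarySymmetroidMatrixDescartes.Census
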